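import Summits.FinalStateConjecture.FinalStateConjecture.Theorems.SwallowTheDatumKerrShieldedSettlesStubExteriorTransportAux
import Summits.FinalStateConjecture.FinalStateConjecture.Statement
import HarnessLib

/-!
# `KerrShieldedSettles`, line `tapered-temporal-collar` — stub S7 `stub_exteriorTransport`, part 3:
# pushing a final-state decomposition of `O_K` through the chart map

Support file for crux `stmt-FinalStateConjecture-10054`
(`Summit.FinalStateConjecture.FinalStateConjecture.Theses.SwallowTheDatum.KerrShieldedSettles`), stub S7
`stub_exteriorTransport`.  Given a chart map `χ : Kerr.region a r₁ → 𝓢` into a spacetime `𝓢` which is smooth, an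
open embedding, isometric and oriented on the tapered collar `W = {0 < x⁰ − T(r) + (r − r₁)/4}`, and a final-state
decomposition `dec` of the Kerr-side region `O_K = {r > r₊, x⁰ ≥ T(r)} ⊆ W` in `C²` all of whose chart values lie in
`O_K`, this part builds the pushed-forward decomposition of `χ(O_K)` (charts `χ ∘ dec.chart i`, `χ ∘ dec.flatChart`,
all other data copied) and proves:

* `ExteriorTransport.deviation_comp_eq` (registered sub-goal `stub_exteriorTransportDeviation`) — **the metric
  deviation is unchanged**: `(χ ∘ Ψ)^* g − g₀ = Ψ^* g_{M,a} − g₀` for every smooth `Ψ` valued in `W` (chain rule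
  `mfderiv_comp` and the isometry `g(dχ v, dχ w) = g_{M,a}(v, w)` on `W`; the "on an open set" version of
  `Spacetime.deviation_comp`), hence every `truncDeviationCk`/`deviationCk` number agrees;
* `ExteriorTransport.isLateChart_comp` — late charts compose with `χ` (smoothness `ContMDiffOn.comp_contMDiff`,
  open embeddings compose after corestricting to the open `W`, Mathlib's `Topology.IsEmbedding.codRestrict`);
* `ExteriorTransport.exists_decomposition_image` — the pushed-forward `FinalStateDecomposition 𝓢 (χ(O_K)) 2` with
  the same (sub-extremal) holes, `charted = χ(dec.charted)` and `HasExhaustiveCharts` (the covering inclusions are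
  push-forwards of the Kerr-side ones through `χ`, part 1 `mem_causalPast_image_of_le`, since every point of
  `O_K` has `x⁰ ≥ T(r)`; `certifiedLate/Slab` of the new decomposition are the `χ`-images of the old ones).

References: B. O'Neill, *Semi-Riemannian geometry* (1983), Ch. 3, p. 58, Ch. 14, pp. 402–403; M. Dafermos,
G. Holzegel, I. Rodnianski, M. Taylor, arXiv:2104.08222, §1 (consequence form of convergence, `KerrConvergence`).

Maintenance record (full-build repair, 2026-08-16). The statement revision p126844 (re-type T2,
2026-08-16T21:18Z) gave `Summit.FinalStateConjecture.HasExhaustiveCharts` a new leading conjunct (honest near-zone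
radii: `Rᵢ → ∞` and `Rᵢ(τ) ≥ max (r₊(Mᵢ,aᵢ)) 0 + 1`), so the final anonymous-constructor step of
`ExteriorTransport.exists_decomposition_image` ("287:25: Application type mismatch" in the full build of
2026-08-16T23:32Z) was one component short. The pushed-forward decomposition `d` has the same `N`, `mass`, `spin`
as `dec`, so the new clause of the hypothesis `hex : HasExhaustiveCharts dec` is handed over unchanged; nothing else
moved. All names, statement texts and the rest of the proof scripts are unchanged.
-/

set_option linter.dupNamespace false

noncomputable section

open Set Filter Function
open scoped Manifold ContDiff Topology
open Literature.Geometry.Lorentzian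
open Summit.FinalStateConjecture.FinalStateConjecture.Theorems.KerrShieldedDataExist.Negative
  (bentHeight mass_pos)

namespace Summit.FinalStateConjecture.FinalStateConjecture.Theorems.SwallowTheDatum.KerrShieldedSettles

namespace ExteriorTransport

/-- An open embedding `f` with values in a set `S`, followed by an open embedding of the subtype `↥S`, is an open
embedding (corestriction `Topology.IsEmbedding.codRestrict`; the corestricted range is the open preimage of
`range f`). [folklore] -/
-- adapted from `isOpenEmbedding_codRestrict`, Literature/AlgebraicTopology/FundamentalGroupoid/SimplyConnectedComplDiscrete.lean
theorem isOpenEmbedding_comp_codRestrict {X Y Z : Type*} [TopologicalSpace X] [TopologicalSpace Y]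
    [TopologicalSpace Z] {f : X → Y} (hf : Topology.IsOpenEmbedding f) {S : Set Y} (hS : ∀ x, f x ∈ S)
    {g : S → Z} (hg : Topology.IsOpenEmbedding g) : Topology.IsOpenEmbedding (g ∘ S.codRestrict f hS) := by
  refine hg.comp ⟨hf.isEmbedding.codRestrict S hS, ?_⟩
  have : range (S.codRestrict f hS) = Subtype.val ⁻¹' range f := by
    ext ⟨y, hy⟩
    simp only [mem_range, mem_preimage, Subtype.ext_iff, val_codRestrict_apply]
  rw [this]
  exact hf.isOpen_range.preimage continuous_subtype_val

/-- Images commute with the "flat chart ∪ ⋃ hole charts" shape of the charted sets of a final-state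
decomposition: `χ(c₀(X₀) ∪ ⋃ᵢ cᵢ(Xᵢ)) = (χ ∘ c₀)(X₀) ∪ ⋃ᵢ (χ ∘ cᵢ)(Xᵢ)`. [folklore] -/
theorem image_shape {K N ι D₀ : Type*} {D : ι → Type*} (χ : K → N) (c₀ : D₀ → K) (c : ∀ i, D i → K)
    (X₀ : Set D₀) (X : ∀ i, Set (D i)) :
    (χ ∘ c₀) '' X₀ ∪ ⋃ i, (χ ∘ c i) '' X i = χ '' (c₀ '' X₀ ∪ ⋃ i, c i '' X i) := by
  rw [Set.image_union, Set.image_iUnion]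
  simp only [Set.image_comp]

/-- The same with the hole charts first: `χ(⋃ᵢ cᵢ(Xᵢ) ∪ c₀(X₀)) = ⋃ᵢ (χ ∘ cᵢ)(Xᵢ) ∪ (χ ∘ c₀)(X₀)`. [folklore] -/
theorem image_shape' {K N ι D₀ : Type*} {D : ι → Type*} (χ : K → N) (c₀ : D₀ → K) (c : ∀ i, D i → K)
    (X₀ : Set D₀) (X : ∀ i, Set (D i)) :
    (⋃ i, (χ ∘ c i) '' X i) ∪ (χ ∘ c₀) '' X₀ = χ '' ((⋃ i, c i '' X i) ∪ c₀ '' X₀) := by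
  rw [Set.image_union, Set.image_iUnion]
  simp only [Set.image_comp]

section Push

variable [Kerr.Facts] {M a r₁ : ℝ} {hM : 0 ≤ M} {𝓢 : Spacetime.{0} 4} {χ : Kerr.region a r₁ → 𝓢.carrier}

/-- **The metric deviation is invariant under composition with the chart map** (registered sub-goal
`stub_exteriorTransportDeviation`): if `χ` is smooth and isometric on the collar `W` and `Ψ : U → Kerr.region a r₁`
is smooth with values in `W`, then `(χ ∘ Ψ)^* g − g₀ = Ψ^* g_{M,a} − g₀` pointwise on `U` (chain rule and the
isometry identity; cf. `Spacetime.deviation_comp` for globally isometric maps). O'Neill 1983, Ch. 3, p. 58; DHRT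
arXiv:2104.08222, §1. [cite: ONeill1983, Ch. 3, p. 58] -/
theorem deviation_comp_eq (hM0 : 0 < M)
    (hχs : ContMDiffOn 𝓘(ℝ, E4) (𝓡 4) ∞ χ
      {x | 0 < (x : E4) 0 - bentHeight M a (Kerr.radius a (x : E4)) + (Kerr.radius a (x : E4) - r₁) / 4})
    (hiso : ∀ x : Kerr.region a r₁, 0 < (x : E4) 0 - bentHeight M a (Kerr.radius a (x : E4)) +
          (Kerr.radius a (x : E4) - r₁) / 4 →
        ∀ v w : E4, 𝓢.metric.val (χ x) (mfderiv 𝓘(ℝ, E4) (𝓡 4) χ x v)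
            (mfderiv 𝓘(ℝ, E4) (𝓡 4) χ x w) = Kerr.bilin M a (x : E4) v w)
    (B : ModelBackground) {Ψ : B.domain → Kerr.region a r₁} (hΨ : ContMDiff 𝓘(ℝ, E4) (𝓡 4) ∞ Ψ)
    (hΨW : ∀ x, 0 < (Ψ x : E4) 0 - bentHeight M a (Kerr.radius a (Ψ x : E4)) + (Kerr.radius a (Ψ x : E4) - r₁) / 4) :
    𝓢.deviation B (χ ∘ Ψ) = (Kerr.spacetime M a r₁ hM).deviation B Ψ := by
  funext x
  ext v w
  rw [Spacetime.deviation_apply, Spacetime.deviation_apply]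
  have hχd : MDifferentiableAt 𝓘(ℝ, E4) (𝓡 4) χ (Ψ x) :=
    ((hχs _ (hΨW x)).contMDiffAt ((CollarEmbedsMGHD.collar M a r₁ hM0).isOpen.mem_nhds (hΨW x))).mdifferentiableAt
      (by simp)
  have hΨd : MDifferentiableAt 𝓘(ℝ, E4) (𝓡 4) Ψ x := hΨ.mdifferentiableAt (by simp)
  rw [mfderiv_comp x hχd hΨd]
  show 𝓢.metric.val (χ (Ψ x)) (mfderiv 𝓘(ℝ, E4) (𝓡 4) χ (Ψ x) (mfderiv 𝓘(ℝ, E4) (𝓡 4) Ψ x v))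
      (mfderiv 𝓘(ℝ, E4) (𝓡 4) χ (Ψ x) (mfderiv 𝓘(ℝ, E4) (𝓡 4) Ψ x w)) - B.bilin x.1 v w =
    Kerr.bilin M a (Ψ x : E4) (mfderiv 𝓘(ℝ, E4) (𝓡 4) Ψ x v) (mfderiv 𝓘(ℝ, E4) (𝓡 4) Ψ x w) - B.bilin x.1 v w
  rw [hiso _ (hΨW x)]

/-- Hence the truncated `Cᵏ` deviations of `χ ∘ Ψ` and of `Ψ` agree. DHRT arXiv:2104.08222, §1.
[cite: arXiv210408222, §1] -/
theorem truncDeviationCk_comp_eq (hM0 : 0 < M)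
    (hχs : ContMDiffOn 𝓘(ℝ, E4) (𝓡 4) ∞ χ
      {x | 0 < (x : E4) 0 - bentHeight M a (Kerr.radius a (x : E4)) + (Kerr.radius a (x : E4) - r₁) / 4})
    (hiso : ∀ x : Kerr.region a r₁, 0 < (x : E4) 0 - bentHeight M a (Kerr.radius a (x : E4)) +
          (Kerr.radius a (x : E4) - r₁) / 4 →
        ∀ v w : E4, 𝓢.metric.val (χ x) (mfderiv 𝓘(ℝ, E4) (𝓡 4) χ x v)
            (mfderiv 𝓘(ℝ, E4) (𝓡 4) χ x w) = Kerr.bilin M a (x : E4) v w)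
    (B : ModelBackground) {Ψ : B.domain → Kerr.region a r₁} (hΨ : ContMDiff 𝓘(ℝ, E4) (𝓡 4) ∞ Ψ)
    (hΨW : ∀ x, 0 < (Ψ x : E4) 0 - bentHeight M a (Kerr.radius a (Ψ x : E4)) + (Kerr.radius a (Ψ x : E4) - r₁) / 4)
    (k : ℕ) (R τ₁ : ℝ) :
    𝓢.truncDeviationCk B (χ ∘ Ψ) k R τ₁ = (Kerr.spacetime M a r₁ hM).truncDeviationCk B Ψ k R τ₁ := by
  unfold Spacetime.truncDeviationCk Spacetime.deviationExtend
  rw [deviation_comp_eq hM0 hχs hiso B hΨ hΨW]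

/-- Hence the full `Cᵏ` deviations of `χ ∘ Ψ` and of `Ψ` agree. DHRT arXiv:2104.08222, §1.
[cite: arXiv210408222, §1] -/
theorem deviationCk_comp_eq (hM0 : 0 < M)
    (hχs : ContMDiffOn 𝓘(ℝ, E4) (𝓡 4) ∞ χ
      {x | 0 < (x : E4) 0 - bentHeight M a (Kerr.radius a (x : E4)) + (Kerr.radius a (x : E4) - r₁) / 4})
    (hiso : ∀ x : Kerr.region a r₁, 0 < (x : E4) 0 - bentHeight M a (Kerr.radius a (x : E4)) +
          (Kerr.radius a (x : E4) - r₁) / 4 →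
        ∀ v w : E4, 𝓢.metric.val (χ x) (mfderiv 𝓘(ℝ, E4) (𝓡 4) χ x v)
            (mfderiv 𝓘(ℝ, E4) (𝓡 4) χ x w) = Kerr.bilin M a (x : E4) v w)
    (B : ModelBackground) {Ψ : B.domain → Kerr.region a r₁} (hΨ : ContMDiff 𝓘(ℝ, E4) (𝓡 4) ∞ Ψ)
    (hΨW : ∀ x, 0 < (Ψ x : E4) 0 - bentHeight M a (Kerr.radius a (Ψ x : E4)) + (Kerr.radius a (Ψ x : E4) - r₁) / 4)
    (k : ℕ) (τ₁ : ℝ) :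
    𝓢.deviationCk B (χ ∘ Ψ) k τ₁ = (Kerr.spacetime M a r₁ hM).deviationCk B Ψ k τ₁ := by
  unfold Spacetime.deviationCk Spacetime.deviationExtend
  rw [deviation_comp_eq hM0 hχs hiso B hΨ hΨW]

/-- **Late charts compose with the chart map**: if `Ψ` is a late chart of the Kerr spacetime into `O ⊆ W` after
`τ₀`, all of whose values lie in `O`, then `χ ∘ Ψ` is a late chart of `𝓢` into `χ(O)` after `τ₀` (smoothness
composes on the open `W`; the open embedding of the late region composes with `χ|_W` after corestriction to `W`).
DHRT arXiv:2104.08222, §1. [cite: arXiv210408222, §1] -/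
theorem isLateChart_comp
    (hχs : ContMDiffOn 𝓘(ℝ, E4) (𝓡 4) ∞ χ
      {x | 0 < (x : E4) 0 - bentHeight M a (Kerr.radius a (x : E4)) + (Kerr.radius a (x : E4) - r₁) / 4})
    (hχe : Topology.IsOpenEmbedding (Set.restrict {x : Kerr.region a r₁ |
      0 < (x : E4) 0 - bentHeight M a (Kerr.radius a (x : E4)) + (Kerr.radius a (x : E4) - r₁) / 4} χ))
    {B : ModelBackground} {O : Set (Kerr.region a r₁)} {τ₀ : ℝ} {Ψ : B.domain → Kerr.region a r₁}
    (hΨ : (Kerr.spacetime M a r₁ hM).IsLateChart B O τ₀ Ψ)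
    (hOW : ∀ x ∈ O, 0 < (x : E4) 0 - bentHeight M a (Kerr.radius a (x : E4)) + (Kerr.radius a (x : E4) - r₁) / 4)
    (hΨO : ∀ x, Ψ x ∈ O) :
    𝓢.IsLateChart B (χ '' O) τ₀ (χ ∘ Ψ) where
  contMDiff := hχs.comp_contMDiff hΨ.contMDiff fun x ↦ hOW _ (hΨO x)
  isOpenEmbedding := isOpenEmbedding_comp_codRestrict hΨ.isOpenEmbedding (fun p ↦ hOW _ (hΨO p.1)) hχe
  image_subset := by
    rintro _ ⟨p, -, rfl⟩
    exact mem_image_of_mem χ (hΨO p)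

/-- **Pushing a final-state decomposition of `O_K` through the chart map.**  Let `χ : Kerr.region a r₁ → 𝓢` be
smooth, an open embedding, isometric and oriented on the collar `W`, and `dec` a `C²` final-state decomposition of
the Kerr spacetime in `O_K = {r > r₊, x⁰ ≥ T(r)}` all of whose chart values lie in `O_K`, with sub-extremal holes
and exhaustive charts.  Then `𝓢` carries a `C²` final-state decomposition `d` of `χ(O_K)` with the same holes,
`d.charted = χ(dec.charted)` and exhaustive charts: charts `χ ∘ dec.chart i`, `χ ∘ dec.flatChart`
(`isLateChart_comp`), identical deviation numbers (`truncDeviationCk_comp_eq`, `deviationCk_comp_eq`), separation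
by injectivity of `χ` on `W`, and the covering inclusions by pushing the Kerr-side ones through `χ`
(`mem_causalPast_image_of_le`: every point of `O_K` has `x⁰ ≥ T(r)`). DHRT arXiv:2104.08222, §1; O'Neill 1983,
Ch. 14, pp. 402–403. [cite: arXiv210408222, §1] -/
theorem exists_decomposition_image (hM0 : 0 < M) (ha : |a| < M) (hr₂ : r₁ < Kerr.rPlus M a)
    (hχs : ContMDiffOn 𝓘(ℝ, E4) (𝓡 4) ∞ χ
      {x | 0 < (x : E4) 0 - bentHeight M a (Kerr.radius a (x : E4)) + (Kerr.radius a (x : E4) - r₁) / 4})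
    (hχe : Topology.IsOpenEmbedding (Set.restrict {x : Kerr.region a r₁ |
      0 < (x : E4) 0 - bentHeight M a (Kerr.radius a (x : E4)) + (Kerr.radius a (x : E4) - r₁) / 4} χ))
    (hχg : ∀ x : Kerr.region a r₁, 0 < (x : E4) 0 - bentHeight M a (Kerr.radius a (x : E4)) +
          (Kerr.radius a (x : E4) - r₁) / 4 →
        (∀ v w : E4, 𝓢.metric.val (χ x) (mfderiv 𝓘(ℝ, E4) (𝓡 4) χ x v)
            (mfderiv 𝓘(ℝ, E4) (𝓡 4) χ x w) = Kerr.bilin M a (x : E4) v w) ∧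
        𝓢.metric.val (χ x) (𝓢.timeOrientation.vectorField (χ x))
            (mfderiv 𝓘(ℝ, E4) (𝓡 4) χ x (Kerr.timeVector M a (x : E4))) < 0)
    (dec : FinalStateDecomposition (Kerr.spacetime M a r₁ hM)
      {x : Kerr.region a r₁ | Kerr.rPlus M a < Kerr.radius a (x : E4) ∧
        bentHeight M a (Kerr.radius a (x : E4)) ≤ (x : E4) 0} 2)
    (hsub : ∀ i, Kerr.IsSubextremal (dec.mass i) (dec.spin i))
    (hex : Summit.FinalStateConjecture.HasExhaustiveCharts dec)
    (hin : ∀ i x, dec.chart i x ∈ {x : Kerr.region a r₁ | Kerr.rPlus M a < Kerr.radius a (x : E4) ∧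
        bentHeight M a (Kerr.radius a (x : E4)) ≤ (x : E4) 0})
    (hin₀ : ∀ x, dec.flatChart x ∈ {x : Kerr.region a r₁ | Kerr.rPlus M a < Kerr.radius a (x : E4) ∧
        bentHeight M a (Kerr.radius a (x : E4)) ≤ (x : E4) 0}) :
    ∃ d : FinalStateDecomposition 𝓢 (χ '' {x : Kerr.region a r₁ | Kerr.rPlus M a < Kerr.radius a (x : E4) ∧
        bentHeight M a (Kerr.radius a (x : E4)) ≤ (x : E4) 0}) 2,
      (∀ i, Kerr.IsSubextremal (d.mass i) (d.spin i)) ∧ d.charted = χ '' dec.charted ∧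
        Summit.FinalStateConjecture.HasExhaustiveCharts d := by
  have hOW : ∀ x ∈ {x : Kerr.region a r₁ | Kerr.rPlus M a < Kerr.radius a (x : E4) ∧
      bentHeight M a (Kerr.radius a (x : E4)) ≤ (x : E4) 0},
      0 < (x : E4) 0 - bentHeight M a (Kerr.radius a (x : E4)) + (Kerr.radius a (x : E4) - r₁) / 4 := by
    intro x hx
    have h1 := hr₂.trans hx.1
    linarith [hx.2]
  have hinj : InjOn χ {x : Kerr.region a r₁ |
      0 < (x : E4) 0 - bentHeight M a (Kerr.radius a (x : E4)) + (Kerr.radius a (x : E4) - r₁) / 4} :=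
    injOn_iff_injective.2 hχe.injective
  have hiso : ∀ x : Kerr.region a r₁, 0 < (x : E4) 0 - bentHeight M a (Kerr.radius a (x : E4)) +
        (Kerr.radius a (x : E4) - r₁) / 4 →
      ∀ v w : E4, 𝓢.metric.val (χ x) (mfderiv 𝓘(ℝ, E4) (𝓡 4) χ x v)
        (mfderiv 𝓘(ℝ, E4) (𝓡 4) χ x w) = Kerr.bilin M a (x : E4) v w := fun x hx ↦ (hχg x hx).1
  -- deviation numbers are unchanged
  have hdev : ∀ i R τ₁, 𝓢.truncDeviationCk
      (boostedKerrBackground (dec.motion i).1 (dec.motion i).2 (dec.mass i) (dec.spin i)) (χ ∘ dec.chart i) 2 R τ₁ =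
      (Kerr.spacetime M a r₁ hM).truncDeviationCk
        (boostedKerrBackground (dec.motion i).1 (dec.motion i).2 (dec.mass i) (dec.spin i)) (dec.chart i) 2 R τ₁ :=
    fun i R τ₁ ↦ truncDeviationCk_comp_eq hM0 hχs hiso _ (dec.isLateChart i).contMDiff (fun x ↦ hOW _ (hin i x)) 2 R τ₁
  have hdev₀ : ∀ τ₁, 𝓢.deviationCk (Minkowski.backgroundOn dec.flatDomain) (χ ∘ dec.flatChart) 2 τ₁ =
      (Kerr.spacetime M a r₁ hM).deviationCk (Minkowski.backgroundOn dec.flatDomain) dec.flatChart 2 τ₁ :=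
    fun τ₁ ↦ deviationCk_comp_eq hM0 hχs hiso _ dec.isLateChart_flat.contMDiff (fun x ↦ hOW _ (hin₀ x)) 2 τ₁
  -- the global covering clause, pushed through `χ`
  have hdiff : χ '' {x : Kerr.region a r₁ | Kerr.rPlus M a < Kerr.radius a (x : E4) ∧
        bentHeight M a (Kerr.radius a (x : E4)) ≤ (x : E4) 0} \
      ((⋃ i, (χ ∘ dec.chart i) ''
          (boostedKerrBackground (dec.motion i).1 (dec.motion i).2 (dec.mass i) (dec.spin i)).lateRegion dec.τ₀) ∪
        (χ ∘ dec.flatChart) '' (Minkowski.backgroundOn dec.flatDomain).lateRegion dec.τ₀) ⊆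
      𝓢.metric.causalPast 𝓢.timeOrientation
        ((⋃ i, (χ ∘ dec.chart i) ''
            (boostedKerrBackground (dec.motion i).1 (dec.motion i).2 (dec.mass i) (dec.spin i)).timeSlab dec.τ₀) ∪
          (χ ∘ dec.flatChart) '' (Minkowski.backgroundOn dec.flatDomain).timeSlab dec.τ₀) := by
    rintro _ ⟨⟨x, hxO, rfl⟩, hq⟩
    have hx : x ∈ {x : Kerr.region a r₁ | Kerr.rPlus M a < Kerr.radius a (x : E4) ∧
        bentHeight M a (Kerr.radius a (x : E4)) ≤ (x : E4) 0} \
        ((⋃ i, dec.chart i ''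
            (boostedKerrBackground (dec.motion i).1 (dec.motion i).2 (dec.mass i) (dec.spin i)).lateRegion dec.τ₀) ∪
          dec.flatChart '' (Minkowski.backgroundOn dec.flatDomain).lateRegion dec.τ₀) := by
      refine ⟨hxO, fun hx' ↦ hq ?_⟩
      rcases hx' with hx' | hx'
      · rw [mem_iUnion] at hx'
        obtain ⟨i, p, hp, hpx⟩ := hx'
        exact Or.inl (mem_iUnion.2 ⟨i, p, hp, by simp only [Function.comp_apply, hpx]⟩)
      · obtain ⟨p, hp, hpx⟩ := hx'
        exact Or.inr ⟨p, hp, by simp only [Function.comp_apply, hpx]⟩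
    have h := dec.diff_subset_causalPast hx
    have h' := mem_causalPast_image_of_le hM0 hM ha hχs hχg hxO.2 h
    rw [image_shape' χ dec.flatChart dec.chart]
    exact h'
  let d : FinalStateDecomposition 𝓢 (χ '' {x : Kerr.region a r₁ | Kerr.rPlus M a < Kerr.radius a (x : E4) ∧
      bentHeight M a (Kerr.radius a (x : E4)) ≤ (x : E4) 0}) 2 :=
    { N := dec.N
      mass := dec.mass
      spin := dec.spin
      mass_pos := dec.mass_pos
      abs_spin_le_mass := dec.abs_spin_le_mass
      motion := dec.motion
      τ₀ := dec.τ₀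
      chart := fun i ↦ χ ∘ dec.chart i
      isLateChart := fun i ↦ isLateChart_comp hχs hχe (dec.isLateChart i) hOW (hin i)
      tendsto_truncDeviationCk := fun i R ↦ by
        show Tendsto (fun τ ↦ 𝓢.truncDeviationCk
          (boostedKerrBackground (dec.motion i).1 (dec.motion i).2 (dec.mass i) (dec.spin i)) (χ ∘ dec.chart i) 2 R τ)
          atTop (𝓝 0)
        simp only [hdev]
        exact dec.tendsto_truncDeviationCk i R
      exists_pairwise_disjoint := fun R ↦ by
        obtain ⟨τ₁, hτ₁⟩ := dec.exists_pairwise_disjoint R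
        refine ⟨τ₁, fun i j hij ↦ ?_⟩
        have h := hτ₁ hij
        change Disjoint (dec.chart i '' _) (dec.chart j '' _) at h
        change Disjoint ((χ ∘ dec.chart i) '' _) ((χ ∘ dec.chart j) '' _)
        refine Set.disjoint_image_image fun b hb c hc heq ↦ ?_
        have hbc : dec.chart i b = dec.chart j c := hinj (hOW _ (hin i b)) (hOW _ (hin j c)) heq
        exact Set.disjoint_left.1 h (mem_image_of_mem _ hb) (by rw [hbc]; exact mem_image_of_mem _ hc)
      excision := dec.excision
      tendsto_excision_div := dec.tendsto_excision_div
      flatDomain := dec.flatDomain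
      setOf_lt_excision_subset_flatDomain := dec.setOf_lt_excision_subset_flatDomain
      flatChart := χ ∘ dec.flatChart
      isLateChart_flat := isLateChart_comp hχs hχe dec.isLateChart_flat hOW hin₀
      tendsto_deviationCk_flat := by
        show Tendsto (fun τ ↦ 𝓢.deviationCk (Minkowski.backgroundOn dec.flatDomain) (χ ∘ dec.flatChart) 2 τ)
          atTop (𝓝 0)
        simp only [hdev₀]
        exact dec.tendsto_deviationCk_flat
      diff_subset_causalPast := hdiff }
  -- the charted region and the certified sets of `d` are the `χ`-images of those of `dec`
  have hcharted : d.charted = χ '' dec.charted := image_shape χ dec.flatChart dec.chart _ _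
  have hlate : ∀ R τ₁, certifiedLate d R τ₁ = χ '' certifiedLate dec R τ₁ := fun R τ₁ ↦
    image_shape χ dec.flatChart dec.chart _ _
  have hslab : ∀ R τ₁, certifiedSlab d R τ₁ = χ '' certifiedSlab dec R τ₁ := fun R τ₁ ↦
    image_shape χ dec.flatChart dec.chart _ _
  refine ⟨d, hsub, hcharted, ?_⟩
  -- statement revision p126844 (2026-08-16): `HasExhaustiveCharts` now opens with the honest-radii clause
  -- `∀ i, Tendsto (R i) atTop atTop ∧ ∀ τ, max (r₊(Mᵢ, aᵢ)) 0 + 1 ≤ R i τ`; `d` copies `N`, `mass`, `spin` from `dec`,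
  -- so that clause transfers verbatim (`hR₀`).
  obtain ⟨R, hR₀, hR₁, hR₂⟩ := hex
  refine ⟨R, hR₀, fun i ↦ ?_, fun τ₁ hτ₁ ↦ ?_⟩
  · show Tendsto (fun τ ↦ 𝓢.truncDeviationCk
      (boostedKerrBackground (dec.motion i).1 (dec.motion i).2 (dec.mass i) (dec.spin i)) (χ ∘ dec.chart i) 2
        (R i τ) τ) atTop (𝓝 0)
    simp only [hdev]
    exact hR₁ i
  · rintro _ ⟨⟨x, hxO, rfl⟩, hq⟩
    rw [hlate] at hq
    have hx : x ∈ {x : Kerr.region a r₁ | Kerr.rPlus M a < Kerr.radius a (x : E4) ∧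
        bentHeight M a (Kerr.radius a (x : E4)) ≤ (x : E4) 0} \ certifiedLate dec R τ₁ :=
      ⟨hxO, fun hx' ↦ hq (mem_image_of_mem χ hx')⟩
    rw [hslab]
    exact mem_causalPast_image_of_le hM0 hM ha hχs hχg hxO.2 (hR₂ τ₁ hτ₁ hx)

end Push

end ExteriorTransport

open ExteriorTransport in
/-- **Registered sub-goal `stub_exteriorTransportDeviation` — the metric deviation is blind to the chart map.**
For a chart map `χ` from the ingoing Kerr–Schild chart into a spacetime `𝓢`, smooth on the tapered collar
`W = {0 < x⁰ − T(r) + (r − r₁)/4}` (`T = bentHeight M a`) and isometric there (`g(dχ v, dχ w) = g_{M,a}(v, w)`), and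
every smooth `Ψ : U → Kerr.region a r₁` on a reference background `B` with values in `W`:
`deviation 𝓢 B (χ ∘ Ψ) = deviation (Kerr.spacetime M a r₁ hM) B Ψ` — so all `Cᵏ` deviation numbers of the
pushed-forward charts of stub S7 `stub_exteriorTransport` equal the Kerr-side ones
(`ExteriorTransport.deviation_comp_eq`). O'Neill 1983, Ch. 3, p. 58; DHRT arXiv:2104.08222, §1.
[cite: ONeill1983, Ch. 3, p. 58] -/
theorem stub_exteriorTransportDeviation : ∀ [Kerr.Facts] (M a r₁ : ℝ) (hM : 0 ≤ M), 0 < M →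
    ∀ (𝓢 : Spacetime.{0} 4) (χ : Kerr.region a r₁ → 𝓢.carrier),
      ContMDiffOn 𝓘(ℝ, E4) (𝓡 4) ((⊤ : ℕ∞) : WithTop ℕ∞) χ
          {x | 0 < (x : E4) 0 - bentHeight M a (Kerr.radius a (x : E4)) + (Kerr.radius a (x : E4) - r₁) / 4} →
      (∀ x : Kerr.region a r₁, 0 < (x : E4) 0 - bentHeight M a (Kerr.radius a (x : E4)) +
            (Kerr.radius a (x : E4) - r₁) / 4 →
          ∀ v w : E4, 𝓢.metric.val (χ x) (mfderiv 𝓘(ℝ, E4) (𝓡 4) χ x v)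
            (mfderiv 𝓘(ℝ, E4) (𝓡 4) χ x w) = Kerr.bilin M a (x : E4) v w) →
      ∀ (B : ModelBackground) (Ψ : B.domain → Kerr.region a r₁),
        ContMDiff 𝓘(ℝ, E4) (𝓡 4) ((⊤ : ℕ∞) : WithTop ℕ∞) Ψ →
        (∀ x, 0 < (Ψ x : E4) 0 - bentHeight M a (Kerr.radius a (Ψ x : E4)) + (Kerr.radius a (Ψ x : E4) - r₁) / 4) →
        𝓢.deviation B (χ ∘ Ψ) = (Kerr.spacetime M a r₁ hM).deviation B Ψ :=
  fun _ _ _ _ hM0 _ _ hχs hiso B _ hΨ hΨW ↦ deviation_comp_eq hM0 hχs hiso B hΨ hΨW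

end Summit.FinalStateConjecture.FinalStateConjecture.Theorems.SwallowTheDatum.KerrShieldedSettles

end
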